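import Summits.QuantumFields.BalabanUV.T4Continuum.Support.NE3HilbertSchmidtTorus
import Mathlib.Analysis.InnerProductSpace.Projection.Basic

/-!
# NE7TensionKernelCoercivity — STEP (E3) OF THE ENERGY ROAD, ITS FUNCTIONAL-ANALYTIC SKELETON: a vector that pairs `θ`-small with the
# kernel of a linear map `Q` and whose image `Q T` is small has `‖T‖² ≤ θ² + ‖QT‖²∕λ` when `Q` is `λ`-coercive on `(ker Q)ᗮ`; and its
# instance on the Hilbert–Schmidt torus 1-forms for the YANG–MILLS TENSION of a configuration

Cell `pub-balaban`, rung (B)+1 sub-cell t4, lineage `b2b-balaban-t4-ne7-p1`, generation 62 (CRUX PROVER NE7 #1, ruling e34b3e0c (2)); hunt (h7)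
«ENERGY ROAD» (`t4/b2b-balaban-t4-ne7-p1-g61/HUNT-H7-ENERGY-ROAD.md`), step (E3) «size of the multiplier».  After gen 62's (E1)
(`NE7FluxGradientFromTension`), the docking (`NE7EtaBackgroundTensionClass.hminE_of_tension`) and (E2)-0 (`NE7TensionPairing`: at a configuration
critical along `ψ` the tension pairing `Σ_x Σ_ν hsR (frame U ψ x ν) (T_ν(x))` is `≤ 12·#Plane·a²·‖ψ‖_{ℓ¹}`; criticality of the `k`-fold constrained
minimiser along every direction tangent to the fibre of the linearised `k`-fold average is the tree's
`NE3CurlPairedResidualMulti.hasDerivAt_fineAction_vary_multiLevel`), the energy-class hypothesis (H∃)ᴱ of route 1 is the `ℓ²`-smallness of the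
tension field `T` of one constrained minimiser per level, about which one knows: (i) `T` pairs `θ`-small with `ker Q`, `Q` = the linearised `k`-fold
average.  THIS file is the abstract step turning (i) into `‖T‖² ≤ θ² + ‖QT‖²∕λ` GIVEN the two remaining analytic inputs, now NAMED IN KERNEL FORM:
(α) `λ`-coercivity of `Q` on `(ker Q)ᗮ` (`λ ≍ L^{−2k}` expected for Bałaban's average in `d = 4`), (β) an `ℓ²` bound on `Q T` (the average of a
covariant divergence over a block is a boundary flux, `‖QT‖² ≲ d³·a²·N^d` expected):

* §1 **`normSq_le_of_kernel_pairing_of_coercive`** (any real inner-product space `E`, complete; any normed `F`; `Q : E →L[ℝ] F`): if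
  `|⟪ψ, T⟫| ≤ θ‖ψ‖` for all `ψ ∈ ker Q` and `λ‖v‖² ≤ ‖Qv‖²` for all `v ∈ (ker Q)ᗮ` (`λ > 0`), then `‖T‖² ≤ θ² + ‖QT‖²∕λ`
  (orthogonal decomposition `T = T₀ + T₁`, `‖T₀‖ ≤ θ`, `λ‖T₁‖² ≤ ‖QT₁‖² = ‖QT‖²`);
* §2 the instance on the NE3 swarm's Hilbert–Schmidt torus 1-forms `NE3HilbertSchmidtTorus.Form d n P` (`⟪·,·⟫ = Σ_{periodBox} Σ_κ hsR`): for a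
  unitary `U`, ANY antisymmetric-flux-form-or-not `B`, the tension `T_ν(x) = Σ_μ ∇_μ^† B_{μν}(x)` and its framed-back torus datum
  `resF P (x ν ↦ Ad_{U(x,ν)}⁻¹ T_ν(x))`: `inner_resF_tension` (its pairing with `b` IS the tension pairing of `NE7TensionPairing` along `extF P b`),
  `norm_sq_resF_tension` (its norm IS the tension energy), and **`tension_energy_le_of_kernel_pairing_of_coercive`**:
  `Σ_{x ∈ periodBox P} Σ_ν nhsNormSq (T_ν(x)) ≤ θ² + ‖Q (resF P T̃)‖²∕λ` under (i), (α) for a given `Q : Form d n P →L[ℝ] F`.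
HONEST FRAMING (page 1): finite-dimensional linear algebra; (α), (β), the identification of `Q` with the linearised `k`-fold average and the
interiority (8) are NOT supplied here; NE7, NE3 NOT PRINTED in [Balaban1984PropagatorsI]–[Balaban1989LargeFieldII] and NOT PROVED; FIXED FINITE
torus, rung (B)+1; continuum YM on T⁴ ⇐ BetaPertH ∧ nine spine estimates (0/9 proved); BetaPertH ⇐ (D1) ∧ (D4) ∧ CAP+tail; G-an2-4 gates asym,
D1 and NE2/3/4; NOT infinite volume, NOT mass gap, NOT Clay.  0 def, 0 sorry.
-/

set_option autoImplicit false

open scoped BigOperators InnerProductSpace Matrix Matrix.Norms.L2Operator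
open Finset

namespace Summit.QuantumFields.BalabanUV.T4Continuum.NE7TensionKernelCoercivity

/-! ## §1 The abstract step -/

section Abstract

variable {E F : Type*} [NormedAddCommGroup E] [InnerProductSpace ℝ E] [CompleteSpace E] [NormedAddCommGroup F] [NormedSpace ℝ F]

/-- **KERNEL PAIRING + COERCIVITY ON THE ORTHOCOMPLEMENT ⇒ SMALLNESS.**  Let `Q : E →L[ℝ] F` (real inner-product space `E`, complete), `T ∈ E`,
`λ > 0`.  If `|⟪ψ, T⟫| ≤ θ·‖ψ‖` for every `ψ ∈ ker Q` and `λ·‖v‖² ≤ ‖Q v‖²` for every `v ∈ (ker Q)ᗮ`, then `‖T‖² ≤ θ² + ‖Q T‖²∕λ`.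
[folklore] -/
theorem normSq_le_of_kernel_pairing_of_coercive (Q : E →L[ℝ] F) {T : E} {θ lam : ℝ} (hlam : 0 < lam)
    (hcrit : ∀ ψ : E, Q ψ = 0 → |⟪ψ, T⟫_ℝ| ≤ θ * ‖ψ‖)
    (hcoer : ∀ v : E, v ∈ (LinearMap.ker (Q : E →ₗ[ℝ] F))ᗮ → lam * ‖v‖ ^ 2 ≤ ‖Q v‖ ^ 2) :
    ‖T‖ ^ 2 ≤ θ ^ 2 + ‖Q T‖ ^ 2 / lam := by
  set K : Submodule ℝ E := LinearMap.ker (Q : E →ₗ[ℝ] F) with hK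
  have hKc : IsClosed (K : Set E) := ContinuousLinearMap.isClosed_ker Q
  haveI : CompleteSpace K := hKc.completeSpace_coe
  haveI : K.HasOrthogonalProjection := Submodule.HasOrthogonalProjection.ofCompleteSpace K
  obtain ⟨T₀, hT₀, T₁, hT₁, hT⟩ := K.exists_add_mem_mem_orthogonal T
  have horth : ⟪T₀, T₁⟫_ℝ = 0 := Submodule.inner_right_of_mem_orthogonal hT₀ hT₁
  have hQT₀ : Q T₀ = 0 := hT₀
  have hQT : Q T = Q T₁ := by rw [hT, map_add, hQT₀, zero_add]
  -- Pythagoras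
  have hpy : ‖T‖ ^ 2 = ‖T₀‖ ^ 2 + ‖T₁‖ ^ 2 := by
    have h := norm_add_sq_eq_norm_sq_add_norm_sq_real horth
    rw [hT, sq, sq, sq]
    exact h
  -- the kernel component: `‖T₀‖² = ⟪T₀, T⟫ ≤ θ‖T₀‖`
  have h0 : ‖T₀‖ ^ 2 ≤ θ * ‖T₀‖ := by
    have e : ⟪T₀, T⟫_ℝ = ‖T₀‖ ^ 2 := by rw [hT, inner_add_right, horth, add_zero, real_inner_self_eq_norm_sq]
    have h := hcrit T₀ hQT₀
    rw [e] at h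
    exact (le_abs_self _).trans h
  have h0' : ‖T₀‖ ^ 2 ≤ θ ^ 2 := by nlinarith [sq_nonneg (θ - ‖T₀‖), norm_nonneg T₀]
  -- (no sign hypothesis on `θ` is needed: `x² ≤ θx`, `x ≥ 0` force `x² ≤ θ²`)
  -- the orthogonal component: `λ‖T₁‖² ≤ ‖Q T₁‖² = ‖Q T‖²`
  have h1 : lam * ‖T₁‖ ^ 2 ≤ ‖Q T‖ ^ 2 := by rw [hQT]; exact hcoer T₁ hT₁
  have h1' : ‖T₁‖ ^ 2 ≤ ‖Q T‖ ^ 2 / lam := by rw [le_div_iff₀ hlam]; linarith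
  rw [hpy]
  linarith

end Abstract

/-! ## §2 The instance on the Hilbert–Schmidt torus 1-forms, for the tension of a configuration -/

section Torus

open Literature.MathematicalPhysics.QuantumFieldTheory.Balaban1983to89
open B7Prop1Explicit B7Prop2Explicit MatrixNorms UnitaryModel
open T4AveragingDeficitWall (IsUnitaryCfg Ad)
open T4AveragingDeficitWallBoundary (periodBox)
open T4AveragingDeficitNonAbelian (Ad_mul)
open AveragingDeficitNearIdentity (Ad_one)
open NE3CovariantCalculus (hsR hsR_self hsR_Ad hsR_Ad_left cDstar)
open NE3CovariantWeitzenbock (frame)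
open NE3HilbertSchmidtTorus

variable {d : ℕ} {n : Type*} [Fintype n] [DecidableEq n]

/-- **THE FRAMED-BACK TENSION DATUM PAIRS AS THE TENSION PAIRING**: for unitary `U`, any `B`, any torus 1-form `b`,
`⟪b, resF P (x ν ↦ Ad_{U(x,ν)}⁻¹ T_ν(x))⟫ = Σ_{x ∈ periodBox P} Σ_ν hsR (frame U (extF P b) x ν) (T_ν(x))`, `T_ν(x) = Σ_μ ∇_μ^† B_{μν}(x)` —
the left slot of `NE7TensionPairing.tension_pairing_le_of_critical` along the periodic extension of `b`. [folklore] -/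
theorem inner_resF_tension {P : ℕ} [NeZero P] {U : Site d → Fin d → (Matrix n n ℂ)ˣ} (hU : IsUnitaryCfg U)
    (B : Site d → Fin d → Fin d → Matrix n n ℂ) (b : Form d n P) :
    ⟪b, resF (d := d) P (fun x ν => Ad (U x ν)⁻¹ (∑ μ : Fin d, cDstar U μ (fun y => B y μ ν) x))⟫_ℝ
      = ∑ x ∈ periodBox (d := d) P, ∑ ν : Fin d,
          hsR (frame U (extF P b) x ν) (∑ μ : Fin d, cDstar U μ (fun y => B y μ ν) x) := by
  conv_lhs => rw [← resF_extF P b]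
  rw [inner_resF]
  refine Finset.sum_congr rfl fun x _ => Finset.sum_congr rfl fun ν _ => ?_
  unfold frame
  rw [hsR_Ad_left (hU x ν)]

/-- **ITS NORM IS THE TENSION ENERGY**: `‖resF P (x ν ↦ Ad_{U(x,ν)}⁻¹ T_ν(x))‖² = Σ_{x ∈ periodBox P} Σ_ν nhsNormSq (T_ν(x))`. [folklore] -/
theorem norm_sq_resF_tension {P : ℕ} {U : Site d → Fin d → (Matrix n n ℂ)ˣ} (hU : IsUnitaryCfg U)
    (B : Site d → Fin d → Fin d → Matrix n n ℂ) :
    ‖resF (d := d) P (fun x ν => Ad (U x ν)⁻¹ (∑ μ : Fin d, cDstar U μ (fun y => B y μ ν) x))‖ ^ 2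
      = ∑ x ∈ periodBox (d := d) P, ∑ ν : Fin d, nhsNormSq (∑ μ : Fin d, cDstar U μ (fun y => B y μ ν) x) := by
  rw [norm_sq_resF]
  -- `nhsNormSq (Ad_u X) = nhsNormSq X` for unitary `u` (the tree's `AveragingDeficitHSInner.nhsNormSq_Ad`, re-derived from `hsR_Ad` to spare the import)
  exact Finset.sum_congr rfl fun x _ => Finset.sum_congr rfl fun ν _ => by
    rw [← hsR_self, hsR_Ad ((unitaryUnits (Matrix n n ℂ)).inv_mem (hU x ν)), hsR_self]

/-- **(E3) IN THE TREE'S VOCABULARY, MODULO ITS TWO ANALYTIC INPUTS.**  Let `U` be unitary, `B` any 2-form (for the flux form: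
`NE7FluxGradientFromTension`), `T_ν(x) = Σ_μ ∇_μ^† B_{μν}(x)` its tension and `T̃ = resF P (x ν ↦ Ad_{U(x,ν)}⁻¹ T_ν(x))` the torus datum.  For a
continuous linear `Q` on the torus 1-forms (to be: the linearised `k`-fold average at `U`) suppose
(i) `|Σ_x Σ_ν hsR (frame U (extF P b) x ν) (T_ν(x))| ≤ θ·‖b‖` for every `b ∈ ker Q` (kernel pairing; from criticality, `NE7TensionPairing`), and
(α) `λ·‖v‖² ≤ ‖Q v‖²` on `(ker Q)ᗮ` (`λ > 0`).  Then the TENSION ENERGY obeys `Σ_{x ∈ periodBox P} Σ_ν nhsNormSq (T_ν(x)) ≤ θ² + ‖Q T̃‖²∕λ` —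
(H∃)ᵀ follows once (β) `‖Q T̃‖²∕λ` is of the order `g′·N^d·(L^k)^d∕(L^k)⁶`. [folklore] -/
theorem tension_energy_le_of_kernel_pairing_of_coercive {P : ℕ} [NeZero P] {U : Site d → Fin d → (Matrix n n ℂ)ˣ} (hU : IsUnitaryCfg U)
    (B : Site d → Fin d → Fin d → Matrix n n ℂ) {F : Type*} [NormedAddCommGroup F] [NormedSpace ℝ F] (Q : Form d n P →L[ℝ] F)
    {θ lam : ℝ} (hlam : 0 < lam)
    (hcrit : ∀ b : Form d n P, Q b = 0 →
      |∑ x ∈ periodBox (d := d) P, ∑ ν : Fin d, hsR (frame U (extF P b) x ν) (∑ μ : Fin d, cDstar U μ (fun y => B y μ ν) x)| ≤ θ * ‖b‖)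
    (hcoer : ∀ v : Form d n P, v ∈ (LinearMap.ker (Q : Form d n P →ₗ[ℝ] F))ᗮ → lam * ‖v‖ ^ 2 ≤ ‖Q v‖ ^ 2) :
    ∑ x ∈ periodBox (d := d) P, ∑ ν : Fin d, nhsNormSq (∑ μ : Fin d, cDstar U μ (fun y => B y μ ν) x)
      ≤ θ ^ 2 + ‖Q (resF (d := d) P (fun x ν => Ad (U x ν)⁻¹ (∑ μ : Fin d, cDstar U μ (fun y => B y μ ν) x)))‖ ^ 2 / lam := by
  rw [← norm_sq_resF_tension (P := P) hU B]
  refine normSq_le_of_kernel_pairing_of_coercive Q hlam (fun b hb => ?_) hcoer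
  rw [inner_resF_tension hU B b]
  exact hcrit b hb

end Torus

/-! ## §3 (v1.1, append-only) Coercivity on `(ker Q)ᗮ` from a bounded RIGHT INVERSE — (α) is an `ℓ²`-bounded LIFT -/

section Lift

variable {E F : Type*} [NormedAddCommGroup E] [InnerProductSpace ℝ E] [CompleteSpace E] [NormedAddCommGroup F] [NormedSpace ℝ F]

omit [CompleteSpace E] in
/-- **A vector orthogonal to `ker Q` is the shortest preimage of its image**: for any right inverse `R` of `Q` (`Q (R φ) = φ`, no linearity
needed) and `v ∈ (ker Q)ᗮ`: `‖v‖ ≤ ‖R (Q v)‖` (`R(Qv) − v ∈ ker Q` is orthogonal to `v`). [folklore] -/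
theorem norm_le_of_rightInverse (Q : E →L[ℝ] F) (R : F → E) (hR : ∀ φ : F, Q (R φ) = φ) {v : E}
    (hv : v ∈ (LinearMap.ker (Q : E →ₗ[ℝ] F))ᗮ) : ‖v‖ ≤ ‖R (Q v)‖ := by
  have hw : R (Q v) - v ∈ LinearMap.ker (Q : E →ₗ[ℝ] F) := by
    show Q (R (Q v) - v) = 0
    rw [map_sub, hR, sub_self]
  have horth : ⟪v, R (Q v) - v⟫_ℝ = 0 := by
    rw [real_inner_comm]
    exact Submodule.inner_right_of_mem_orthogonal hw hv
  have h := norm_add_sq_eq_norm_sq_add_norm_sq_real horth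
  rw [add_sub_cancel] at h
  have h2 : ‖v‖ ^ 2 ≤ ‖R (Q v)‖ ^ 2 := by rw [sq, sq]; nlinarith [h, mul_self_nonneg ‖R (Q v) - v‖]
  exact (pow_le_pow_iff_left₀ (norm_nonneg _) (norm_nonneg _) two_ne_zero).mp h2

omit [CompleteSpace E] in
/-- **(α) FROM A LIFT**: if `Q` has a right inverse `R` with `‖R φ‖ ≤ ρ·‖φ‖` (`ρ > 0`) — an `ℓ²`-BOUNDED LIFT of coarse data to fine data, as the
tree's face ∕ spread lifts of the linearised average (`AveragingDeficitFaceLift`, `NE3SpreadLift…`, `levelQ'_onto`) — then `Q` is `ρ^{−2}`-coercive on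
`(ker Q)ᗮ`: `(ρ²)⁻¹·‖v‖² ≤ ‖Q v‖²`. [folklore] -/
theorem coercive_of_rightInverse (Q : E →L[ℝ] F) (R : F → E) (hR : ∀ φ : F, Q (R φ) = φ) {ρ : ℝ} (hρ0 : 0 < ρ)
    (hρ : ∀ φ : F, ‖R φ‖ ≤ ρ * ‖φ‖) :
    ∀ v : E, v ∈ (LinearMap.ker (Q : E →ₗ[ℝ] F))ᗮ → (ρ ^ 2)⁻¹ * ‖v‖ ^ 2 ≤ ‖Q v‖ ^ 2 := by
  intro v hv
  have h2 : ‖v‖ ≤ ρ * ‖Q v‖ := (norm_le_of_rightInverse Q R hR hv).trans (hρ _)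
  rw [inv_mul_le_iff₀ (pow_pos hρ0 2)]
  have h3 := mul_self_le_mul_self (norm_nonneg v) h2
  nlinarith [h3]

/-- **KERNEL PAIRING + A BOUNDED LIFT ⇒ SMALLNESS**: `|⟪ψ, T⟫| ≤ θ‖ψ‖` on `ker Q` and a right inverse `R` of `Q` with `‖R φ‖ ≤ ρ‖φ‖` give
`‖T‖² ≤ θ² + ρ²·‖Q T‖²`. [folklore] -/
theorem normSq_le_of_kernel_pairing_of_rightInverse (Q : E →L[ℝ] F) {T : E} {θ : ℝ}
    (hcrit : ∀ ψ : E, Q ψ = 0 → |⟪ψ, T⟫_ℝ| ≤ θ * ‖ψ‖) (R : F → E) (hR : ∀ φ : F, Q (R φ) = φ) {ρ : ℝ} (hρ0 : 0 < ρ)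
    (hρ : ∀ φ : F, ‖R φ‖ ≤ ρ * ‖φ‖) :
    ‖T‖ ^ 2 ≤ θ ^ 2 + ρ ^ 2 * ‖Q T‖ ^ 2 := by
  have h := normSq_le_of_kernel_pairing_of_coercive Q (lam := (ρ ^ 2)⁻¹) (inv_pos.mpr (pow_pos hρ0 2)) hcrit
    (coercive_of_rightInverse Q R hR hρ0 hρ)
  rw [div_inv_eq_mul, mul_comm] at h
  exact h

end Lift

section TorusLift

open Literature.MathematicalPhysics.QuantumFieldTheory.Balaban1983to89
open B7Prop1Explicit B7Prop2Explicit MatrixNorms UnitaryModel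
open T4AveragingDeficitWall (IsUnitaryCfg Ad)
open T4AveragingDeficitWallBoundary (periodBox)
open NE3CovariantCalculus (hsR cDstar)
open NE3CovariantWeitzenbock (frame)
open NE3HilbertSchmidtTorus

variable {d : ℕ} {n : Type*} [Fintype n] [DecidableEq n]

/-- **(E3) MODULO (α′) A BOUNDED LIFT AND (β)**: as `tension_energy_le_of_kernel_pairing_of_coercive`, with the coercivity hypothesis replaced by an
`ℓ²`-bounded right inverse `R` of `Q` (`Q (R φ) = φ`, `‖R φ‖ ≤ ρ‖φ‖`): the tension energy is `≤ θ² + ρ²·‖Q T̃‖²`.  For the linearised `k`-fold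
average one expects `ρ² ≍ L^{k(d−2)}` (each coarse bond value spread over `L^{k(d−1)}·L^k` fine bonds with weight `L^{−k}`). [folklore] -/
theorem tension_energy_le_of_kernel_pairing_of_lift {P : ℕ} [NeZero P] {U : Site d → Fin d → (Matrix n n ℂ)ˣ} (hU : IsUnitaryCfg U)
    (B : Site d → Fin d → Fin d → Matrix n n ℂ) {F : Type*} [NormedAddCommGroup F] [NormedSpace ℝ F] (Q : Form d n P →L[ℝ] F)
    {θ : ℝ}
    (hcrit : ∀ b : Form d n P, Q b = 0 →
      |∑ x ∈ periodBox (d := d) P, ∑ ν : Fin d, hsR (frame U (extF P b) x ν) (∑ μ : Fin d, cDstar U μ (fun y => B y μ ν) x)| ≤ θ * ‖b‖)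
    (R : F → Form d n P) (hR : ∀ φ : F, Q (R φ) = φ) {ρ : ℝ} (hρ0 : 0 < ρ) (hρ : ∀ φ : F, ‖R φ‖ ≤ ρ * ‖φ‖) :
    ∑ x ∈ periodBox (d := d) P, ∑ ν : Fin d, nhsNormSq (∑ μ : Fin d, cDstar U μ (fun y => B y μ ν) x)
      ≤ θ ^ 2 + ρ ^ 2 * ‖Q (resF (d := d) P (fun x ν => Ad (U x ν)⁻¹ (∑ μ : Fin d, cDstar U μ (fun y => B y μ ν) x)))‖ ^ 2 := by
  have h := tension_energy_le_of_kernel_pairing_of_coercive hU B Q (lam := (ρ ^ 2)⁻¹) (inv_pos.mpr (pow_pos hρ0 2)) hcrit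
    (coercive_of_rightInverse Q R hR hρ0 hρ)
  rw [div_inv_eq_mul, mul_comm ( _ ^ 2) (ρ ^ 2)] at h
  exact h

end TorusLift

/-! ## §4 (v1.2, append-only) THE LEG PART OF THE AVERAGE IS GAUGE: `ker S ≤ ker Q ⊔ range d` when `Q = S + D ∘ Λ` and `Q ∘ d = D ∘ r`, `r` onto -/

section Gauge

variable {R : Type*} [CommRing R] {E F H Hf : Type*} [AddCommGroup E] [Module R E] [AddCommGroup F] [Module R F]
  [AddCommGroup H] [Module R H] [AddCommGroup Hf] [Module R Hf]

/-- **THE LEG PART IS GAUGE.**  Let the linearised average split as `Q = S + D ∘ Λ` (`S` = the STRAIGHT block-line average, `Λ` = the leg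
functional into coarse 0-forms, `D` = the coarse gradient), let `d` be the fine gauge map (gradient of fine 0-forms) and `r` the restriction of fine
0-forms to coarse 0-forms, and suppose GAUGE COVARIANCE `Q ∘ d = D ∘ r` (the average of a pure gauge is the coarse pure gauge of the restricted
generator — Bałaban's (42) is gauge covariant) with `r` onto.  Then every `ψ ∈ ker S` is a `ker Q` direction plus a pure gauge: `ker S ≤ ker Q ⊔ range d`
(take `λ` with `r λ = Λ ψ`; then `Q (ψ − d λ) = D Λ ψ − D r λ = 0`).  Consequence for the energy road: a tension that pairs small with `ker Q`
(criticality) and with the gauge modes (gauge invariance of the action) pairs small with `ker S`, so (α), (β) are to be asked of the STRAIGHT average `S`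
(flat symbol two-sided, `c = 1∕3`; the average of a divergence telescopes transversally), not of `Q`. [folklore] -/
theorem ker_le_ker_sup_range_of_gauge_covariant (S Q : E →ₗ[R] F) (Λ : E →ₗ[R] H) (D : H →ₗ[R] F) (d : Hf →ₗ[R] E) (r : Hf →ₗ[R] H)
    (hQ : Q = S + D.comp Λ) (hcov : Q.comp d = D.comp r) (hr : Function.Surjective r) :
    LinearMap.ker S ≤ LinearMap.ker Q ⊔ LinearMap.range d := by
  intro ψ hψ
  rw [LinearMap.mem_ker] at hψ
  obtain ⟨lam, hlam⟩ := hr (Λ ψ)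
  have hQd : Q (d lam) = D (r lam) := by
    have h := LinearMap.congr_fun hcov lam
    simpa using h
  have hker : ψ - d lam ∈ LinearMap.ker Q := by
    rw [LinearMap.mem_ker, map_sub, hQd, hlam, hQ]
    simp [hψ]
  exact Submodule.mem_sup.mpr ⟨ψ - d lam, hker, d lam, LinearMap.mem_range_self d lam, sub_add_cancel ψ (d lam)⟩

/-- **THE PAIRING FORM** of the same fact (any additive functional `τ`, e.g. `τ ψ = ⟪ψ, T⟫`): if `τ` vanishes on `ker Q` and on the gauge modes
`range d`, it vanishes on `ker S`. [folklore] -/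
theorem pairing_eq_zero_on_ker_of_gauge_covariant (S Q : E →ₗ[R] F) (Λ : E →ₗ[R] H) (D : H →ₗ[R] F) (d : Hf →ₗ[R] E) (r : Hf →ₗ[R] H)
    (hQ : Q = S + D.comp Λ) (hcov : Q.comp d = D.comp r) (hr : Function.Surjective r) (τ : E →ₗ[R] R)
    (hQτ : ∀ ψ, Q ψ = 0 → τ ψ = 0) (hdτ : ∀ lam, τ (d lam) = 0) : ∀ ψ, S ψ = 0 → τ ψ = 0 := by
  intro ψ hψ
  have hmem : ψ ∈ LinearMap.ker Q ⊔ LinearMap.range d :=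
    ker_le_ker_sup_range_of_gauge_covariant S Q Λ D d r hQ hcov hr (LinearMap.mem_ker.mpr hψ)
  obtain ⟨y, hy, z, hz, hyz⟩ := Submodule.mem_sup.mp hmem
  obtain ⟨lam, rfl⟩ := LinearMap.mem_range.mp hz
  rw [← hyz, map_add, hQτ y (LinearMap.mem_ker.mp hy), hdτ lam, add_zero]

end Gauge

/-! ## §5 (v1.3, append-only) THE EXACT-CURRENT FORM OF (E3): an EXACT annihilator `τ` of `ker S` that is `θ₀`-close to `⟪·, T⟫`, plus TWO-SIDED
bounds for `S` on `(ker S)ᗮ`, give `‖T‖² ≤ 4‖ST‖²∕λ + (4Λ²∕λ + 2)·θ₀²` — no decomposition of tangent directions, no θ-budget -/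

section ExactCurrent

variable {E F : Type*} [NormedAddCommGroup E] [InnerProductSpace ℝ E] [CompleteSpace E] [NormedAddCommGroup F] [NormedSpace ℝ F]

/-- **(E3) WITH AN EXACT CURRENT.**  Let `S : E →L[ℝ] F`, `T ∈ E`, and `τ : E →L[ℝ] ℝ` a functional that VANISHES on `ker S` (to be: the exact first
variation of the Wilson action, which annihilates `ker Q` by criticality and the gauge modes by invariance, hence `ker S` by §4) and is `θ₀`-close to
pairing with `T`: `|τ ψ − ⟪ψ, T⟫| ≤ θ₀·‖ψ‖` (to be: `NE7TensionPairing` with `θ₀ = 12·#Plane·a²·√(d·P^d·card n)`).  If `λ·‖v‖² ≤ ‖S v‖²` on `(ker S)ᗮ`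
(`λ > 0`) and `‖S v‖ ≤ Λ·‖v‖` everywhere (`Λ ≥ 0`), then `‖T‖² ≤ 4·‖S T‖²∕λ + (4·Λ²∕λ + 2)·θ₀²`.  (Riesz: `τ = ⟪T̂, ·⟫` with `T̂ ∈ (ker S)ᗮ`;
`λ‖T̂‖² ≤ ‖ST̂‖² ≤ (‖ST‖ + Λθ₀)²`; `‖T‖ ≤ ‖T̂‖ + θ₀`.)  For the straight block-line average the flat symbol gives `Λ²∕λ = 3`. [folklore] -/
theorem normSq_le_of_exact_annihilator (S : E →L[ℝ] F) {T : E} (τ : E →L[ℝ] ℝ) {θ₀ lam Lam : ℝ} (hθ₀ : 0 ≤ θ₀) (hlam : 0 < lam) (hLam : 0 ≤ Lam)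
    (hτS : ∀ ψ : E, S ψ = 0 → τ ψ = 0) (hτT : ∀ ψ : E, |τ ψ - ⟪ψ, T⟫_ℝ| ≤ θ₀ * ‖ψ‖)
    (hcoer : ∀ v : E, v ∈ (LinearMap.ker (S : E →ₗ[ℝ] F))ᗮ → lam * ‖v‖ ^ 2 ≤ ‖S v‖ ^ 2) (hS : ∀ v : E, ‖S v‖ ≤ Lam * ‖v‖) :
    ‖T‖ ^ 2 ≤ 4 * ‖S T‖ ^ 2 / lam + (4 * Lam ^ 2 / lam + 2) * θ₀ ^ 2 := by
  -- the Riesz representative of `τ`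
  set That : E := (InnerProductSpace.toDual ℝ E).symm τ with hThat
  have hrep : ∀ ψ : E, ⟪That, ψ⟫_ℝ = τ ψ := fun ψ => InnerProductSpace.toDual_symm_apply
  -- `T̂ ⊥ ker S`
  have hmem : That ∈ (LinearMap.ker (S : E →ₗ[ℝ] F))ᗮ := by
    rw [Submodule.mem_orthogonal']
    intro u hu
    rw [hrep u]
    exact hτS u hu
  -- `‖T̂ − T‖ ≤ θ₀`
  have hdist : ‖That - T‖ ≤ θ₀ := by
    have h := hτT (That - T)
    have e : τ (That - T) - ⟪That - T, T⟫_ℝ = ‖That - T‖ ^ 2 := by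
      rw [← hrep (That - T), ← real_inner_comm (That - T) T, ← inner_sub_left, real_inner_self_eq_norm_sq]
    rw [e] at h
    -- `‖That − T‖² ≤ θ₀‖That − T‖`
    have h' : ‖That - T‖ ^ 2 ≤ θ₀ * ‖That - T‖ := (le_abs_self _).trans h
    nlinarith [norm_nonneg (That - T), sq_nonneg (θ₀ - ‖That - T‖)]
  -- coercivity on `T̂` and the size of `S T̂`
  have h1 : lam * ‖That‖ ^ 2 ≤ ‖S That‖ ^ 2 := hcoer That hmem
  have h2 : ‖S That‖ ≤ ‖S T‖ + Lam * θ₀ := by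
    have e : S That = S T + S (That - T) := by rw [map_sub]; abel
    rw [e]
    refine (norm_add_le _ _).trans ?_
    have h3 : ‖S (That - T)‖ ≤ Lam * θ₀ := (hS _).trans (mul_le_mul_of_nonneg_left hdist hLam)
    linarith
  have h4 : ‖T‖ ≤ ‖That‖ + θ₀ := by
    have e : T = That - (That - T) := by abel
    rw [e]
    exact (norm_sub_le _ _).trans (by linarith)
  -- assemble: ‖T‖² ≤ 2‖T̂‖² + 2θ₀², λ‖T̂‖² ≤ (‖ST‖ + Λθ₀)² ≤ 2‖ST‖² + 2Λ²θ₀²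
  have h5 : ‖T‖ ^ 2 ≤ 2 * ‖That‖ ^ 2 + 2 * θ₀ ^ 2 := by
    nlinarith [h4, norm_nonneg T, norm_nonneg That, sq_nonneg (‖That‖ - θ₀)]
  have h6 : ‖S That‖ ^ 2 ≤ 2 * ‖S T‖ ^ 2 + 2 * (Lam * θ₀) ^ 2 := by
    nlinarith [h2, norm_nonneg (S That), norm_nonneg (S T), mul_nonneg hLam hθ₀, sq_nonneg (‖S T‖ - Lam * θ₀)]
  have h7 : ‖That‖ ^ 2 ≤ (2 * ‖S T‖ ^ 2 + 2 * (Lam * θ₀) ^ 2) / lam := by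
    rw [le_div_iff₀ hlam]; linarith
  have e : 4 * ‖S T‖ ^ 2 / lam + (4 * Lam ^ 2 / lam + 2) * θ₀ ^ 2 = 2 * ((2 * ‖S T‖ ^ 2 + 2 * (Lam * θ₀) ^ 2) / lam) + 2 * θ₀ ^ 2 := by
    field_simp
    ring
  rw [e]
  linarith

end ExactCurrent

section TorusExact

open Literature.MathematicalPhysics.QuantumFieldTheory.Balaban1983to89
open B7Prop1Explicit B7Prop2Explicit MatrixNorms UnitaryModel
open T4AveragingDeficitWall (IsUnitaryCfg Ad)
open T4AveragingDeficitWallBoundary (periodBox)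
open NE3CovariantCalculus (hsR cDstar)
open NE3CovariantWeitzenbock (frame)
open NE3HilbertSchmidtTorus

variable {d : ℕ} {n : Type*} [Fintype n] [DecidableEq n]

/-- **(E3) WITH AN EXACT CURRENT, ON THE TORUS 1-FORMS.**  As `normSq_le_of_exact_annihilator` for the framed-back tension datum `T̃` of a unitary `U`
and any `B`: a functional `τ` on `Form d n P` vanishing on `ker S` with `|τ b − Σ_x Σ_ν hsR (frame U (extF P b) x ν) (T_ν(x))| ≤ θ₀‖b‖`, and two-sided
bounds `λ ≤ S^*S ≤ Λ²` in the stated sense, give  `Σ_{x ∈ periodBox P} Σ_ν nhsNormSq (T_ν(x)) ≤ 4‖S T̃‖²∕λ + (4Λ²∕λ + 2)·θ₀²`. [folklore] -/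
theorem tension_energy_le_of_exact_annihilator {P : ℕ} [NeZero P] {U : Site d → Fin d → (Matrix n n ℂ)ˣ} (hU : IsUnitaryCfg U)
    (B : Site d → Fin d → Fin d → Matrix n n ℂ) {F : Type*} [NormedAddCommGroup F] [NormedSpace ℝ F] (S : Form d n P →L[ℝ] F)
    (τ : Form d n P →L[ℝ] ℝ) {θ₀ lam Lam : ℝ} (hθ₀ : 0 ≤ θ₀) (hlam : 0 < lam) (hLam : 0 ≤ Lam)
    (hτS : ∀ b : Form d n P, S b = 0 → τ b = 0)
    (hτT : ∀ b : Form d n P,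
      |τ b - ∑ x ∈ periodBox (d := d) P, ∑ ν : Fin d, hsR (frame U (extF P b) x ν) (∑ μ : Fin d, cDstar U μ (fun y => B y μ ν) x)| ≤ θ₀ * ‖b‖)
    (hcoer : ∀ v : Form d n P, v ∈ (LinearMap.ker (S : Form d n P →ₗ[ℝ] F))ᗮ → lam * ‖v‖ ^ 2 ≤ ‖S v‖ ^ 2)
    (hS : ∀ v : Form d n P, ‖S v‖ ≤ Lam * ‖v‖) :
    ∑ x ∈ periodBox (d := d) P, ∑ ν : Fin d, nhsNormSq (∑ μ : Fin d, cDstar U μ (fun y => B y μ ν) x)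
      ≤ 4 * ‖S (resF (d := d) P (fun x ν => Ad (U x ν)⁻¹ (∑ μ : Fin d, cDstar U μ (fun y => B y μ ν) x)))‖ ^ 2 / lam
        + (4 * Lam ^ 2 / lam + 2) * θ₀ ^ 2 := by
  rw [← norm_sq_resF_tension (P := P) hU B]
  refine normSq_le_of_exact_annihilator S τ hθ₀ hlam hLam hτS (fun b => ?_) hcoer hS
  rw [inner_resF_tension hU B b]
  exact hτT b

end TorusExact

end Summit.QuantumFields.BalabanUV.T4Continuum.NE7TensionKernelCoercivity
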